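import Summits.RiemannHypothesis.RiemannHypothesis.Theorems.TiltedLandingLaw421R3Lens1PinningIsoB
import Summits.RiemannHypothesis.RiemannHypothesis.Theorems.TiltedLandingLaw421R3RateBooksQ1b

/-! # ★A FIRST LEMMA v2 (lens-2 g4, O4-c; v2 = primed pinning, no `CleanFeet`): at a CHARGED level, EVERY Jensen-isolated band state has a non-real child in its closed disc —
far OR approach (no lateral `R/2` window is used)

Memo `rh33346-cover/lens2/APPROACH-MEMO-v1.md` §4.  The classification FAR / APPROACH of the RATE books (`RhW08.SealSwapQ.FarLevelQ`,
`ApproachLevelQ`, tree `…R3RateBooksQ1b`) is by the LATERAL near window `|Re z − Re v| < R/2`; the child-existence mechanism needs only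
DISC-clearness (`RhW08.Lens1PinningIso.JensenIsolated`).  ★ `child_of_charged_jensenIsolated`: in an `EngineHyps5 2` frame, at a CHARGED
level `j`, any band state `v ∈ StTrkDQ j` (lowest or not, far or not) that is Jensen-isolated has a zero `w` of `f⁽ʲ⁺¹⁾` with `Im w ≠ 0` in
its closed Jensen disc (`NestedStep v w`) — lens-1's landed `pinning_of_jensenIsolated'` (#1152, dirty feet, closed base) + «`Charged ⇒` no NL
event of level `j` on the closed diameter» (the diameter lies in the `TiltReady` window by the `StColQ'` budget); v2 = v1 with the primed pinning
cited and the `CleanFeet` binder DROPPED (director (CA566), crit-1 l.7825): class α := «lowest band state Jensen-isolated», full stop.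
★ `child_of_charged_jensenIsolated_approach`:
the same at an APPROACH level (`ApproachLevelQ`, i.e. `¬FarLevelQ ∧ ¬ConsLevelQ`) — recorded to make the point that approach levels of the
Jensen-isolated kind («class α» of the memo) are inside the reach of the RATE side's CHILD mechanism (NOT of its field cap: crit-1 l.7825,
(CA566)(2)).  Checked by import of tree modules only; 0 `sorry`; no instances/notation.  Nothing here bears on the truth of RH; RH is not proved; 33346/33347 OPEN; checked ≠ proved. -/

noncomputable section

open Complex Metric Set
open scoped Real ComplexConjugate

namespace RhW08.ChildCount

open RhIdea6.G17.W07C7 RhIdea6.G17.W07C7.Rev6 RhIdea6.G18.W07C8.Law421BirthS RhIdea6.G19.W07C11.Seam RhIdea6.G20.W07C12.Frac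
  RhIdea6.G20.W07C12.StColP RhW07.C12.FieldSplit RhW08.Round1 RhW08.StSwap RhW08.Round2 RhW08.QuadW RhW08.SealSwapQ in
open RhW08.SealSwap (PBot) in
/-- (K) at a CHARGED level `j`, the closed diameter of ANY band state `v ∈ StTrkDQ j` carries no NL event of level `j`
(`Charged ⇒ ¬ReadyR2 ⇒ ¬TiltReady j`; the diameter `|x − Re v| ≤ Im v` lies in the window `|x − x₀| < (j+3)R/2` by the `StColQ'` budget). -/
theorem no_nlEvent_on_diameter_of_charged {η : ℝ} {f : ℂ → ℂ} {x₀ s hmax R Hs : ℝ} {B : ℕ} (hE : EngineHyps5 2 η f x₀ s hmax R Hs B)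
    {j : ℕ} {v : ℂ} (hC : Charged (PTrkSQ PBot) StTrkDQ ReadyR2 η f x₀ s hmax R Hs B j)
    (hst : StTrkDQ η f x₀ s hmax R Hs B j v) :
    ∀ x : ℝ, |x - v.re| ≤ v.im → ¬ NLEventOf f j x := by
  have hbud : (max (|v.re - x₀| - R / 2) 0) ^ 2 + (j : ℝ) * v.im ^ 2 ≤ (j : ℝ) * Hs ^ 2 := hst.2.2.2.1
  obtain ⟨-, -, -, hs, hsh, hhR, -, hHs0, -, hHsR, -⟩ := hE
  have hR : 0 < R := by linarith
  have hwin : ∀ x : ℝ, |x - v.re| ≤ v.im → |x - x₀| < ((j : ℝ) + 3) * R / 2 := by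
    intro x hx
    have hm0 : 0 ≤ max (|v.re - x₀| - R / 2) 0 := le_max_right _ _
    have hm1 : |v.re - x₀| - R / 2 ≤ max (|v.re - x₀| - R / 2) 0 := le_max_left _ _
    have hj : (0 : ℝ) ≤ j := Nat.cast_nonneg j
    have hvHs : v.im ≤ Hs := hst.2.2.2.2
    have hm2 : (max (|v.re - x₀| - R / 2) 0) ^ 2 ≤ (j : ℝ) * (R / 2) ^ 2 := by
      have h1 : (max (|v.re - x₀| - R / 2) 0) ^ 2 ≤ (j : ℝ) * Hs ^ 2 := by nlinarith [sq_nonneg v.im]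
      have h2 : Hs ^ 2 ≤ (R / 2) ^ 2 := by nlinarith
      nlinarith
    have hm3 : max (|v.re - x₀| - R / 2) 0 ≤ (j : ℝ) * (R / 2) := by
      have hj2 : (j : ℝ) ≤ (j : ℝ) ^ 2 := by
        rcases Nat.eq_zero_or_pos j with h0 | hpos
        · simp [h0]
        · have : (1 : ℝ) ≤ j := by exact_mod_cast hpos
          nlinarith
      have h4 : (max (|v.re - x₀| - R / 2) 0) ^ 2 ≤ ((j : ℝ) * (R / 2)) ^ 2 := by nlinarith [sq_nonneg R]
      exact (pow_le_pow_iff_left₀ hm0 (by positivity) two_ne_zero).1 h4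
    have h5 := abs_sub_le x v.re x₀
    nlinarith
  obtain ⟨v', -, hnr, -⟩ := hC
  intro x hx hNL
  apply hnr
  unfold ReadyR2 CumReady WinOrTilt TiltReady
  exact ⟨j, le_rfl, Or.inr ⟨x, hwin x hx, hNL⟩⟩

open RhIdea6.G17.W07C7 RhIdea6.G17.W07C7.Rev6 RhIdea6.G18.W07C8.Law421BirthS RhIdea6.G19.W07C11.Seam RhIdea6.G20.W07C12.Frac
  RhIdea6.G20.W07C12.StColP RhW07.C12.FieldSplit RhW08.Round1 RhW08.StSwap RhW08.Round2 RhW08.QuadW RhW08.SealSwapQ in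
open RhW08.SealSwap (PBot) in
open RhW08.Lens1PinningIso (JensenIsolated pinning_of_jensenIsolated') in
/-- ★ (K) **CHILD AT A CHARGED LEVEL, NO LATERAL WINDOW, ANY FEET**: any Jensen-isolated band state at a charged level has a non-real zero
of `f⁽ʲ⁺¹⁾` in its closed Jensen disc.  (lens-1's `pinning_of_jensenIsolated'`; its closed-base NL-event branch is killed by `Charged`.) -/
theorem child_of_charged_jensenIsolated {η : ℝ} {f : ℂ → ℂ} {x₀ s hmax R Hs : ℝ} {B : ℕ} (hE : EngineHyps5 2 η f x₀ s hmax R Hs B)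
    {j : ℕ} {v : ℂ} (hC : Charged (PTrkSQ PBot) StTrkDQ ReadyR2 η f x₀ s hmax R Hs B j)
    (hst : StTrkDQ η f x₀ s hmax R Hs B j v) (hJ : JensenIsolated f j v) :
    ∃ w : ℂ, iteratedDeriv (j + 1) f w = 0 ∧ w.im ≠ 0 ∧ NestedStep v w := by
  have hnoNL := no_nlEvent_on_diameter_of_charged hE hC hst
  rcases pinning_of_jensenIsolated' hE hst.2.1 hst.2.2.1 hJ with h | ⟨x, hx, hNL⟩
  · exact h
  · exact absurd hNL (hnoNL x hx)

open RhIdea6.G17.W07C7 RhIdea6.G17.W07C7.Rev6 RhIdea6.G18.W07C8.Law421BirthS RhIdea6.G19.W07C11.Seam RhIdea6.G20.W07C12.Frac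
  RhIdea6.G20.W07C12.StColP RhW07.C12.FieldSplit RhW08.Round1 RhW08.StSwap RhW08.Round2 RhW08.QuadW RhW08.SealSwapQ in
open RhW08.SealSwap (PBot) in
open RhW08.Lens1PinningIso (JensenIsolated) in
/-- ★ (K) **… IN PARTICULAR AT AN APPROACH LEVEL** (`ApproachLevelQ j`: the level is neither far — a foreign zero of `f⁽ʲ⁾` within `R/2`
laterally of every lowest band state — nor consumption): the lowest band state, if Jensen-isolated (any feet), still has its non-real
child in the closed disc.  (Class α of the ★A memo := «lowest band state Jensen-isolated»: the CHILD mechanism does not see the lateral window;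
the field CAP does — crit-1 l.7825.) -/
theorem child_of_charged_jensenIsolated_approach {η : ℝ} {f : ℂ → ℂ} {x₀ s hmax R Hs : ℝ} {B : ℕ}
    (hE : EngineHyps5 2 η f x₀ s hmax R Hs B) {j : ℕ} {v : ℂ}
    (hC : Charged (PTrkSQ PBot) StTrkDQ ReadyR2 η f x₀ s hmax R Hs B j) (_hA : ApproachLevelQ η f x₀ s hmax R Hs B j)
    (hlow : IsLowest StTrkDQ η f x₀ s hmax R Hs B j v) (hJ : JensenIsolated f j v) :
    ∃ w : ℂ, iteratedDeriv (j + 1) f w = 0 ∧ w.im ≠ 0 ∧ NestedStep v w :=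
  child_of_charged_jensenIsolated hE hC hlow.1 hJ

end RhW08.ChildCount
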